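import Mathlib
import Summits.NavierStokesRegularity.FluidComputer.CarrierFloorWindow

/-!
# The rim route's two obstacles priced in rate × time — gap lemmas, the record, and what the reversal instant sits next to

Cell `pub-fluidc` (FLUID COMPUTER; host summit `NavierStokesRegularity`, negation side, machine paradigm), prover seat p1 (gen 19, 2026-08-27).
HONEST FRAMING: low prior, high value-of-information experiment on Tao's machine paradigm; NOT a claim that NS blows up.
Nothing here is about the Navier–Stokes equations. The LEAD's NOTE 10 (2) (HOME/PLAN §8ii; START-HERE S12) names two obstacles for a 'rim-fed' memo on
the record's rings: (O1) the level-two content riding on the ring's rim has amplitude ≈ 0.3 of the band's sup carrier and must become the sup carrier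
('amp ×3') inside the floor-crossing window; (O2) the injection class feeding it reverses near t 1.70. This file types p1's reader `rim_obstacles.py` 0.1.0
(deposit `atlas/rung-next/p1/spatial/floor-window/RIM-OBSTACLES.md`, README ADDENDUM C; HOME/STATUS p1 gen 19 INFORMATION #9):
* §1 is elementary real analysis on top of `CarrierLifeCycle` §1: if a positive quantity `R` has logarithmic rate (reader's convention, `d ln R²/dt`) at most
  `ρ` and another, `S`, at least `σ` on a window `[a, b]`, the RATIO `R/S` grows at most by `exp ((ρ − σ)(b − a)/2)`; so for `R` to overtake `S` from a ratio
  `≤ a₀` the product GAP × LENGTH must reach `2·log (1/a₀)`; with `a₀ ≤ 0.32` a product `≤ 2.25` never does (`0.32 · e^{1.125} < 1`).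
* §2 the record of (O1) on the rings D-128 / D-192 / E-128: late-window amplitude ratio, the SUP carrier's cap total beside `CarrierFloorWindow.rim`'s rim total,
  the class gap and the realised gap; consequences of §1: no gap of the record's size — nor a frozen SUP — overtakes inside the window.
* §3 the record of (O2): the rim's injection class falls linearly (slope −4.8 per unit, R² ≥ 0.99) from +3 at t 1.00 to zero at t_inj0 = 1.60–1.64, where the
  level-one cap strain reads +1.51…+1.55 — the END of WINDOW(1.5) of `CarrierFloorWindow` §2 — 0.10–0.19 after cos(ω₁, ω₂) at the rim passes through zero;
  offsets to the other level-one milestones; F-128 as the one out-of-sample clock; the injection-vs-orientation least-squares line.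
* §4 the two obstacles compounded by switch-on instant.
Words: none. Rates are cap-averaged CLASS log-rates of |ω₂|² at a NON-material moving site (the level-one ω-argmax); the realised amplitude is printed beside
the class gap because the two differ on D. 128³ rows (D also 192³). 0 sorry; no named fact.
-/

noncomputable section

open Set

namespace Summit.NavierStokesRegularity.FluidComputer.RimRoutePrice

open Summit.NavierStokesRegularity.FluidComputer.CarrierLifeCycle (growth_of_lograte_ge growth_of_lograte_le)
open Summit.NavierStokesRegularity.FluidComputer.CarrierFloorWindow (ring rim)

/-! ## §1 Ratio growth under a rate gap; the gap × length an overtake needs -/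

/-- **RATIO GROWTH UNDER A RATE GAP.** `R, S > 0` continuous on `[a, b]`, differentiable inside, with `d ln R²/dt ≤ ρ` (`2R' ≤ ρR`) and `d ln S²/dt ≥ σ`
(`σS ≤ 2S'`): then `R b / S b ≤ (R a / S a) · exp ((ρ − σ)(b − a)/2)` — an amplitude RATIO moves at half the rate GAP. -/
theorem ratio_growth_le {R S : ℝ → ℝ} {a b ρ σ : ℝ} (hab : a ≤ b) (hR : ∀ x ∈ Icc a b, 0 < R x) (hS : ∀ x ∈ Icc a b, 0 < S x)
    (hRc : ContinuousOn R (Icc a b)) (hSc : ContinuousOn S (Icc a b)) (hRd : DifferentiableOn ℝ R (Ioo a b)) (hSd : DifferentiableOn ℝ S (Ioo a b))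
    (hRrate : ∀ x ∈ Ioo a b, 2 * deriv R x ≤ ρ * R x) (hSrate : ∀ x ∈ Ioo a b, σ * S x ≤ 2 * deriv S x) :
    R b / S b ≤ R a / S a * Real.exp ((ρ - σ) * (b - a) / 2) := by
  have h1 := growth_of_lograte_le hab hR hRc hRd hRrate
  have h2 := growth_of_lograte_ge hab hS hSc hSd hSrate
  have hRa := hR a (left_mem_Icc.2 hab)
  have hSa := hS a (left_mem_Icc.2 hab)
  calc R b / S b ≤ R a * Real.exp (ρ * (b - a) / 2) / (S a * Real.exp (σ * (b - a) / 2)) :=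
        div_le_div₀ (by positivity) h1 (by positivity) h2
    _ = R a / S a * Real.exp ((ρ - σ) * (b - a) / 2) := by
        rw [mul_div_mul_comm, ← Real.exp_sub]; congr 1; ring_nf

/-- **WHAT AN OVERTAKE NEEDS.** Under the hypotheses of `ratio_growth_le`, if the ratio starts at most `a₀` (`R a / S a ≤ a₀`) and `R` has overtaken `S` at `b`
(`S b ≤ R b`), then `1 ≤ a₀ · exp ((ρ − σ)(b − a)/2)`. -/
theorem one_le_of_overtake {R S : ℝ → ℝ} {a b ρ σ a0 : ℝ} (hab : a ≤ b) (hR : ∀ x ∈ Icc a b, 0 < R x) (hS : ∀ x ∈ Icc a b, 0 < S x)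
    (hRc : ContinuousOn R (Icc a b)) (hSc : ContinuousOn S (Icc a b)) (hRd : DifferentiableOn ℝ R (Ioo a b)) (hSd : DifferentiableOn ℝ S (Ioo a b))
    (hRrate : ∀ x ∈ Ioo a b, 2 * deriv R x ≤ ρ * R x) (hSrate : ∀ x ∈ Ioo a b, σ * S x ≤ 2 * deriv S x)
    (h0 : R a / S a ≤ a0) (hover : S b ≤ R b) : 1 ≤ a0 * Real.exp ((ρ - σ) * (b - a) / 2) := by
  have hSb := hS b (right_mem_Icc.2 hab)
  have h := ratio_growth_le hab hR hS hRc hSc hRd hSd hRrate hSrate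
  have h1 : 1 ≤ R b / S b := by rw [le_div_iff₀ hSb, one_mul]; exact hover
  exact h1.trans (h.trans (mul_le_mul_of_nonneg_right h0 (Real.exp_pos _).le))

/-- The same in logarithms: an overtake from ratio `≤ a₀` (`a₀ > 0`) needs GAP × LENGTH `(ρ − σ)(b − a) ≥ 2·log (1/a₀)`. -/
theorem gap_mul_length_ge_of_overtake {a0 x : ℝ} (ha0 : 0 < a0) (h : 1 ≤ a0 * Real.exp (x / 2)) : 2 * Real.log (1 / a0) ≤ x := by
  have hx : Real.log 1 ≤ Real.log (a0 * Real.exp (x / 2)) := Real.log_le_log one_pos h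
  rw [Real.log_one, Real.log_mul ha0.ne' (Real.exp_pos _).ne', Real.log_exp] at hx
  rw [one_div, Real.log_inv]; linarith

/-- `exp (9/8) < 2.7182818286 · 8/7` (from `exp 1 < 2.7182818286` and `exp (1/8) < 1/(1 − 1/8)`). -/
theorem exp_nine_eighths_lt : Real.exp (9 / 8) < 2.7182818286 * (8 / 7) := by
  have h1 := Real.exp_one_lt_d9
  have h2 : Real.exp (1 / 8) < 1 / (1 - 1 / 8) := Real.exp_bound_div_one_sub_of_interval' (by norm_num) (by norm_num)
  rw [show (9:ℝ) / 8 = 1 + 1 / 8 by norm_num, Real.exp_add]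
  calc Real.exp 1 * Real.exp (1 / 8) < 2.7182818286 * (1 / (1 - 1 / 8)) :=
        mul_lt_mul'' h1 h2 (Real.exp_pos _).le (Real.exp_pos _).le
    _ = 2.7182818286 * (8 / 7) := by norm_num

/-- **THE THRESHOLD AS A NUMBER.** From an amplitude ratio `a₀ ≤ 0.32`, a GAP × LENGTH product `x ≤ 2.25` does not overtake: `a₀ · exp (x/2) < 1`.
(So `2·log(1/0.32) > 2.25`; the reader prints 2.28. No sign hypothesis on `a₀` is needed.) -/
theorem no_overtake_of_product_le {a0 x : ℝ} (ha' : a0 ≤ 0.32) (hx : x ≤ 2.25) : a0 * Real.exp (x / 2) < 1 := by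
  have hexp : Real.exp (x / 2) ≤ Real.exp (9 / 8) := Real.exp_le_exp.2 (by linarith)
  calc a0 * Real.exp (x / 2) ≤ 0.32 * Real.exp (9 / 8) := mul_le_mul ha' hexp (Real.exp_pos _).le (by norm_num)
    _ < 0.32 * (2.7182818286 * (8 / 7)) := by have := exp_nine_eighths_lt; nlinarith
    _ < 1 := by norm_num

/-- **REQUIRED GAPS.** Budget `τ` and gap `G` with `G·τ ≤ 2.25` do not overtake from `a₀ ≤ 0.32`; in particular (the reader's three budgets):
the whole window `τ ≤ 0.5` needs `G > 4.5`, LEAD NOTE 10 (2)'s `τ ≤ 0.30` needs `G > 7.5`, a mid-window switch-on `τ ≤ 0.24` needs `G > 9.375`. -/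
theorem no_overtake_of_gap_le {a0 G τ Gmax τmax : ℝ} (ha' : a0 ≤ 0.32) (hτ : 0 ≤ τ) (hτ' : τ ≤ τmax) (hG : G ≤ Gmax) (hGmax : 0 ≤ Gmax)
    (hprod : Gmax * τmax ≤ 2.25) : a0 * Real.exp (G * τ / 2) < 1 := by
  apply no_overtake_of_product_le ha'
  calc G * τ ≤ Gmax * τ := mul_le_mul_of_nonneg_right hG hτ
    _ ≤ Gmax * τmax := mul_le_mul_of_nonneg_left hτ' hGmax
    _ ≤ 2.25 := hprod

/-- The three budgets of record as instances of `no_overtake_of_gap_le`. -/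
theorem required_gaps {a0 G τ : ℝ} (ha' : a0 ≤ 0.32) (hτ : 0 ≤ τ) :
    (τ ≤ 0.5 → G ≤ 4.5 → a0 * Real.exp (G * τ / 2) < 1) ∧ (τ ≤ 0.30 → G ≤ 7.5 → a0 * Real.exp (G * τ / 2) < 1) ∧
    (τ ≤ 0.24 → G ≤ 9.375 → a0 * Real.exp (G * τ / 2) < 1) :=
  ⟨fun h1 h2 => no_overtake_of_gap_le ha' hτ h1 h2 (by norm_num) (by norm_num),
   fun h1 h2 => no_overtake_of_gap_le ha' hτ h1 h2 (by norm_num) (by norm_num),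
   fun h1 h2 => no_overtake_of_gap_le ha' hτ h1 h2 (by norm_num) (by norm_num)⟩

/-! ## §2 The record of (O1) on the rings (`rim_obstacles.py` §1; rows WINDOW 1.15–1.65 / LATE 1.40–1.65; rings `0` = D-128, `1` = D-192, `2` = E-128) -/

/-- One ring's (O1) row: the amplitude ratio and the SUP carrier's cap totals beside the rim's (the rim totals are `CarrierFloorWindow.rim`). -/
structure GapRow where
  /-- amp at rows 1.15 / 1.40 / 1.65 -/
  a115 : ℝ
  a140 : ℝ
  a165 : ℝ
  /-- LATE-row mean of amp (the `a₀` of §1) -/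
  aLate : ℝ
  /-- SUP carrier (band argmax) cap total, window mean -/
  supTotW : ℝ
  /-- SUP carrier cap total, late mean -/
  supTotL : ℝ
  /-- SUP carrier's window classes: strain / BACK / injection -/
  supStrainW : ℝ
  supBackW : ℝ
  supInjW : ℝ
  /-- class gap rim − SUP, window mean -/
  gapW : ℝ
  /-- class gap, late mean -/
  gapL : ℝ
  /-- realised gap = log-rate of amp² banked over 1.15 → 1.65 -/
  gapMeasW : ℝ

/-- the three rings' (O1) rows of record. -/
def gap : Fin 3 → GapRow :=
  ![⟨0.25, 0.31, 0.23, 0.32, 1.48, 1.21, -0.12, 0.31, 1.35, 1.32, 1.82, -0.34⟩,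
    ⟨0.28, 0.32, 0.23, 0.28, 1.21, 0.91, -0.25, 0.35, 1.25, 1.48, 2.12, -0.67⟩,
    ⟨0.30, 0.35, 0.37, 0.32, 1.36, 1.08, -0.24, 0.46, 1.22, 1.20, 1.65, 0.88⟩]

/-- **THE AMPLITUDE RATIO IS FLAT AT ≈ 0.3**: every printed amp ∈ [0.23, 0.37], late mean ∈ [0.28, 0.32] (≤ §1's 0.32); the realised gap ≤ +0.88 (negative on D). -/
theorem amp_flat (i : Fin 3) :
    (0.23 ≤ (gap i).a115 ∧ (gap i).a115 ≤ 0.37) ∧ (0.23 ≤ (gap i).a140 ∧ (gap i).a140 ≤ 0.37) ∧ (0.23 ≤ (gap i).a165 ∧ (gap i).a165 ≤ 0.37) ∧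
    (0.28 ≤ (gap i).aLate ∧ (gap i).aLate ≤ 0.32) ∧ (gap i).gapMeasW ≤ 0.88 := by
  fin_cases i <;> simp [gap] <;> norm_num

/-- **THE SUP CARRIER BESIDE THE RIM IS THE INJECTION-FED HARMONIC**: strain ≤ −0.12, BACK ∈ [0.31, 0.46], injection ≥ 1.22, total +0.9…+1.5 — against the rim's
total ≥ +2.5 (`CarrierFloorWindow.rim_strain_and_back_fed`); the class gap of record is +1.20…+1.48 (window), +1.65…+2.12 (late) and is, to rounding, the
difference of the two totals. -/
theorem sup_is_injection_fed_and_gap_of_record (i : Fin 3) :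
    ((gap i).supStrainW ≤ -0.12 ∧ 0.31 ≤ (gap i).supBackW ∧ 1.22 ≤ (gap i).supInjW ∧ 0.91 ≤ (gap i).supTotL ∧ (gap i).supTotW ≤ 1.48) ∧
    (1.20 ≤ (gap i).gapW ∧ (gap i).gapW ≤ 1.48 ∧ 1.65 ≤ (gap i).gapL ∧ (gap i).gapL ≤ 2.12) ∧
    (|(rim i).totW - (gap i).supTotW - (gap i).gapW| ≤ 0.005 ∧ |(rim i).totL - (gap i).supTotL - (gap i).gapL| ≤ 0.005) := by
  fin_cases i <;> simp [gap, rim] <;> norm_num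

/-- **NO GAP OF THE RECORD'S SIZE OVERTAKES INSIDE THE WINDOW.** With the late class gap (≤ 2.12) sustained over the longest window of record (0.52, `CarrierFloorWindow`
§2: t_s(1.5) − t_floor ≤ 0.523) the product is ≤ 1.11 < 2.25, so from `aLate ≤ 0.32` the rim content does not reach the sup: `aLate · exp (gapL · 0.523 / 2) < 1`. -/
theorem record_gap_cannot_overtake (i : Fin 3) : (gap i).aLate * Real.exp ((gap i).gapL * 0.523 / 2) < 1 := by
  obtain ⟨-, -, -, ⟨-, h2⟩, -⟩ := amp_flat i
  obtain ⟨-, ⟨-, -, -, h3⟩, -⟩ := sup_is_injection_fed_and_gap_of_record i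
  exact no_overtake_of_gap_le h2 (by norm_num) le_rfl h3 (by norm_num) (by norm_num)

/-- **EVEN A FROZEN SUP IS SHORT.** If the sup carrier did not grow at all (gap = the rim's own late total ≤ 3.03, `CarrierFloorWindow.rim`), the product over 0.523
is ≤ 1.59 < 2.25: still no overtake inside the window; the reader's 'time needed' at that gap is 0.76–0.84 > 0.52. -/
theorem frozen_sup_cannot_overtake (i : Fin 3) : (gap i).aLate * Real.exp ((rim i).totL * 0.523 / 2) < 1 := by
  obtain ⟨-, -, -, ⟨-, h2⟩, -⟩ := amp_flat i
  have h3 : (rim i).totL ≤ 3.03 := by fin_cases i <;> norm_num [rim]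
  exact no_overtake_of_gap_le h2 (by norm_num) le_rfl h3 (by norm_num) (by norm_num)

/-- The largest 0.30-sustained cap total at ANY deposited site of any leg (E, level-one u-argmax, rows 1.75–2.05) is +5.90: as a GAP it is short at τ = 0.30
(product 1.77) and would suffice only over a full 0.5 (2.95 ≥ 2.25) against a sup that does not grow. -/
theorem largest_site_total_vs_budgets : (5.90 : ℝ) * 0.30 < 2.25 ∧ (2.25 : ℝ) < 5.90 * 0.50 := by norm_num

/-! ## §3 The record of (O2): the reversal instant (`rim_obstacles.py` §2) -/

/-- One ring's (O2) row. Instants: `tInj0` (injection class at the rim through zero, interpolated), `tTot0` (total through zero = growth stops), `tPerp`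
(cos(ω₁, ω₂) through zero); the linear fit of the injection class over rows 1.00 → the last row before `tInj0`; the level-one carrier's readings AT `tInj0`;
level-one milestones not already in `CarrierFloorWindow.ring` (strain₁ zero, BACK₁ switch-on ≤ −0.5 × 3, BACK₁ ≤ −1). -/
structure RevRow where
  /-- injection class at the rim at t 1.00 -/
  inj100 : ℝ
  /-- least-squares slope per unit time -/
  slope : ℝ
  /-- its R² -/
  r2 : ℝ
  tInj0 : ℝ
  tTot0 : ℝ
  tPerp : ℝ
  /-- level-one cap strain at tInj0 (interpolated) -/
  strain1 : ℝ
  /-- level-one cap BACK at tInj0 -/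
  back1 : ℝ
  /-- r₁(tInj0) / r₁ final -/
  r1Frac : ℝ
  /-- U₁(tInj0)/U₁max -/
  u1Frac : ℝ
  /-- level-one strain zero -/
  tSz1 : ℝ
  /-- level-one BACK switch-on -/
  tBon1 : ℝ
  /-- level-one BACK ≤ −1 -/
  tB1 : ℝ

/-- the three rings' (O2) rows of record (D-128 / D-192 / E-128). -/
def rev : Fin 3 → RevRow :=
  ![⟨3.10, -4.81, 0.99, 1.638, 1.744, 1.509, 1.54, 0.12, 0.84, 0.84, 2.275, 2.50, 2.60⟩,
    ⟨3.06, -4.77, 1.00, 1.620, 1.724, 1.426, 1.51, 0.00, 0.82, 0.82, 2.263, 2.45, 2.65⟩,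
    ⟨2.96, -4.84, 1.00, 1.596, 1.710, 1.494, 1.55, 0.05, 0.81, 0.81, 2.218, 2.45, 2.65⟩]

/-- **A LINEAR DECAY FIXED BEFORE THE WINDOW OPENS**: from +2.96…+3.10 at t 1.00 the rim's injection class falls at −4.77…−4.84 per unit with R² ≥ 0.99; the fit
starts at 1.00, ≥ 0.12 BEFORE the floor crossing (`CarrierFloorWindow.ring`: t_floor 1.127–1.135), and the zero falls 0.46–0.51 after the floor. -/
theorem linear_decay_from_before_the_floor (i : Fin 3) :
    (2.96 ≤ (rev i).inj100 ∧ (rev i).inj100 ≤ 3.10) ∧ (-4.84 ≤ (rev i).slope ∧ (rev i).slope ≤ -4.77) ∧ 0.99 ≤ (rev i).r2 ∧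
    (1.00 + 0.12 ≤ (ring i).tFloor ∧ 0.46 ≤ (rev i).tInj0 - (ring i).tFloor ∧ (rev i).tInj0 - (ring i).tFloor ≤ 0.51) := by
  fin_cases i <;> simp [rev, ring] <;> norm_num

/-- **THE REVERSAL IS THE WINDOW'S OWN END.** On every ring the injection zero t_inj0 ∈ [1.59, 1.64] lies within 0.06 of t_s(1.5) (`CarrierFloorWindow.ring`, lattice
0.05), and AT t_inj0 the level-one carrier reads cap strain₁ ∈ [1.51, 1.55] (leaving winner class), BACK₁ ∈ [0, 0.12], r₁ at 0.81–0.84 of final, U₁/U₁max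
0.81–0.84; the rim content's growth stops 0.10–0.12 later (t_tot0 ∈ [1.71, 1.75] = the '1.70' of the earlier read). -/
theorem reversal_is_window_end (i : Fin 3) :
    (1.59 ≤ (rev i).tInj0 ∧ (rev i).tInj0 ≤ 1.64 ∧ |(rev i).tInj0 - (ring i).tS15| ≤ 0.06) ∧
    (1.51 ≤ (rev i).strain1 ∧ (rev i).strain1 ≤ 1.55 ∧ 0 ≤ (rev i).back1 ∧ (rev i).back1 ≤ 0.12) ∧
    (0.81 ≤ (rev i).r1Frac ∧ (rev i).r1Frac ≤ 0.84 ∧ 0.81 ≤ (rev i).u1Frac ∧ (rev i).u1Frac ≤ 0.84) ∧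
    (0.10 ≤ (rev i).tTot0 - (rev i).tInj0 ∧ (rev i).tTot0 - (rev i).tInj0 ≤ 0.12 ∧ 1.71 ≤ (rev i).tTot0 ∧ (rev i).tTot0 ≤ 1.75) := by
  fin_cases i <;> simp [rev, ring] <;> norm_num

/-- **PERPENDICULAR FIRST, THEN THE ZERO**: cos(ω₁, ω₂) at the rim passes through zero 0.10–0.20 before the injection class does. -/
theorem perpendicular_precedes_reversal (i : Fin 3) : 0.10 ≤ (rev i).tInj0 - (rev i).tPerp ∧ (rev i).tInj0 - (rev i).tPerp ≤ 0.20 := by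
  fin_cases i <;> simp [rev] <;> norm_num

/-- **ONE LEVEL-ONE CLOCK, SO EVERY OFFSET IS TIGHT.** Offsets t_inj0 − milestone on the three rings: t_floor +0.46…+0.51, strain₁-max +0.18…+0.22, t_U1 −0.48…−0.41,
strain₁-zero −0.65…−0.62, BACK₁ switch-on −0.87…−0.83, BACK₁ ≤ −1 −1.06…−0.96 — each within a band of width ≤ 0.10, because D (two grids) and E differ by
≤ 0.06 on every milestone. The table cannot single out one milestone; F is the only out-of-sample clock (`F_out_of_sample`). -/
theorem offsets_all_tight (i : Fin 3) :
    (0.46 ≤ (rev i).tInj0 - (ring i).tFloor ∧ (rev i).tInj0 - (ring i).tFloor ≤ 0.51) ∧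
    (0.18 ≤ (rev i).tInj0 - (ring i).tStrainMax ∧ (rev i).tInj0 - (ring i).tStrainMax ≤ 0.22) ∧
    (-0.48 ≤ (rev i).tInj0 - (ring i).tU1 ∧ (rev i).tInj0 - (ring i).tU1 ≤ -0.41) ∧
    (-0.65 ≤ (rev i).tInj0 - (rev i).tSz1 ∧ (rev i).tInj0 - (rev i).tSz1 ≤ -0.62) ∧
    (-0.87 ≤ (rev i).tInj0 - (rev i).tBon1 ∧ (rev i).tInj0 - (rev i).tBon1 ≤ -0.83) ∧
    (-1.06 ≤ (rev i).tInj0 - (rev i).tB1 ∧ (rev i).tInj0 - (rev i).tB1 ≤ -0.96) := by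
  fin_cases i <;> simp [rev, ring] <;> norm_num

/-- Pairwise: the three rings' level-one milestones agree to ≤ 0.06 (floor, strain max, t_U1 from `CarrierFloorWindow.ring`; strain zero, BACK instants here). -/
theorem rings_share_one_clock (i j : Fin 3) :
    |(ring i).tFloor - (ring j).tFloor| ≤ 0.06 ∧ |(ring i).tStrainMax - (ring j).tStrainMax| ≤ 0.06 ∧ |(ring i).tU1 - (ring j).tU1| ≤ 0.06 ∧
    |(rev i).tSz1 - (rev j).tSz1| ≤ 0.06 ∧ |(rev i).tBon1 - (rev j).tBon1| ≤ 0.06 ∧ |(rev i).tB1 - (rev j).tB1| ≤ 0.06 := by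
  fin_cases i <;> fin_cases j <;> simp [rev, ring] <;> norm_num

/-- F-128 (P3-ring at ν₀, no WINDOW(1.5); its rim site is the relocated argmax from 1.10): injection at 1.00, slope, R², t_inj0, t_floor, t_U1, strain₁ zero,
BACK₁ switch-on, BACK₁ ≤ −1, strain₁ at t_inj0. -/
structure RevF where
  inj100 : ℝ
  slope : ℝ
  r2 : ℝ
  tInj0 : ℝ
  tFloor : ℝ
  tU1 : ℝ
  tSz1 : ℝ
  tBon1 : ℝ
  tB1 : ℝ
  strain1 : ℝ

/-- F's row of record. -/
def revF : RevF := ⟨3.96, -3.45, 0.93, 2.032, 1.385, 2.05, 2.565, 2.35, 3.00, 0.83⟩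

/-- **F, THE ONE OUT-OF-SAMPLE CLOCK**: a slower decay (−3.45, R² 0.93) reversing at 2.03 with strain₁ only +0.83 there; its offsets sit nearest the rings' for
BACK₁ ≤ −1 (−0.97 vs −1.06…−0.96) and strain₁-zero (−0.53 vs −0.65…−0.62), and far from the rings' t_floor (+0.65 vs ≤ +0.51) and t_U1 (−0.02 vs ≤ −0.41) offsets. -/
theorem F_out_of_sample :
    (revF.slope = -3.45 ∧ revF.r2 = 0.93 ∧ revF.strain1 < 1.5) ∧
    (-0.97 ≤ revF.tInj0 - revF.tB1 ∧ revF.tInj0 - revF.tB1 ≤ -0.96) ∧ (-0.54 ≤ revF.tInj0 - revF.tSz1 ∧ revF.tInj0 - revF.tSz1 ≤ -0.53) ∧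
    (0.64 ≤ revF.tInj0 - revF.tFloor) ∧ (-0.02 ≤ revF.tInj0 - revF.tU1) := by
  simp [revF]; norm_num

/-- The injection-vs-orientation least-squares line at the rim (rows 1.00 → the last pre-relocation row; a companion number, not a law): inj ≈ α + β·cos(ω₁, ω₂). -/
structure InjCos where
  alpha : ℝ
  beta : ℝ
  r2 : ℝ
  /-- cos at which the line crosses inj = 0 -/
  cos0 : ℝ

/-- the three rings' lines of record. -/
def injCos : Fin 3 → InjCos := ![⟨1.02, 2.32, 0.88, -0.44⟩, ⟨0.91, 3.32, 0.95, -0.27⟩, ⟨0.92, 2.60, 0.93, -0.35⟩]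

/-- **THE INJECTION CLASS READS THE ORIENTATION**: α ∈ [0.91, 1.02] (≈ +1 at perpendicular), β ∈ [2.32, 3.32] (≈ +3…+4 along the ring's vorticity, ≈ −1.4…−2.4
against it), R² ≥ 0.88, zero at cos ∈ [−0.44, −0.27] (just past perpendicular) — consistent with `perpendicular_precedes_reversal` and with
`CarrierRimOrientation`'s after-window anti-parallel reading. -/
theorem injection_reads_orientation (i : Fin 3) :
    (0.91 ≤ (injCos i).alpha ∧ (injCos i).alpha ≤ 1.02) ∧ (2.32 ≤ (injCos i).beta ∧ (injCos i).beta ≤ 3.32) ∧ 0.88 ≤ (injCos i).r2 ∧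
    (-0.44 ≤ (injCos i).cos0 ∧ (injCos i).cos0 ≤ -0.27) ∧ |(injCos i).alpha + (injCos i).beta * (injCos i).cos0| ≤ 0.02 := by
  fin_cases i <;> simp [injCos] <;> norm_num

/-! ## §4 The two obstacles compounded by switch-on instant -/

/-- Budget before the reversal for a leak switching on at `t_on`: `tInj0 − t_on`. From the floor crossing it is the whole window (0.46–0.51); from
t_floor + 0.25 it is 0.21–0.26; and the injection the leak meets at t_floor + 0.25 on the fitted line, `inj100 + slope·(t_floor + 0.25 − 1)`, is already ≤ +1.3. -/
theorem budget_by_switch_on (i : Fin 3) :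
    (0.46 ≤ (rev i).tInj0 - (ring i).tFloor ∧ (rev i).tInj0 - (ring i).tFloor ≤ 0.51) ∧
    (0.21 ≤ (rev i).tInj0 - ((ring i).tFloor + 0.25) ∧ (rev i).tInj0 - ((ring i).tFloor + 0.25) ≤ 0.26) ∧
    (rev i).inj100 + (rev i).slope * ((ring i).tFloor + 0.25 - 1) ≤ 1.3 := by
  fin_cases i <;> simp [rev, ring] <;> norm_num

/-- **COMPOUNDED.** A leak at the floor crossing needs a rim-over-SUP gap `G > 4.4` sustained to the reversal (product ≤ 4.4 × 0.51 < 2.25 otherwise); a leak at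
t_floor + 0.25 needs `G > 8.6` (8.6 × 0.26 < 2.25) — against the record's late class gap ≤ 2.12, a frozen SUP ≤ 3.03, and the largest sustained site total 5.90. -/
theorem compounded (i : Fin 3) {G : ℝ} :
    (G ≤ 4.4 → (gap i).aLate * Real.exp (G * ((rev i).tInj0 - (ring i).tFloor) / 2) < 1) ∧
    (G ≤ 8.6 → (gap i).aLate * Real.exp (G * ((rev i).tInj0 - ((ring i).tFloor + 0.25)) / 2) < 1) ∧
    ((gap i).gapL < 4.4 ∧ (rim i).totL < 4.4 ∧ (4.4 : ℝ) < 5.90 ∧ (5.90 : ℝ) < 8.6) := by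
  obtain ⟨-, -, -, ⟨-, h2⟩, -⟩ := amp_flat i
  obtain ⟨⟨hb1, hb2⟩, ⟨hb3, hb4⟩, -⟩ := budget_by_switch_on i
  obtain ⟨-, ⟨-, -, -, hg⟩, -⟩ := sup_is_injection_fed_and_gap_of_record i
  have hr : (rim i).totL ≤ 3.03 := by fin_cases i <;> norm_num [rim]
  refine ⟨fun hG => no_overtake_of_gap_le h2 (by linarith) hb2 hG (by norm_num) (by norm_num),
    fun hG => no_overtake_of_gap_le h2 (by linarith) hb4 hG (by norm_num) (by norm_num), ⟨by linarith, by linarith, by norm_num, by norm_num⟩⟩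

/-! ## §5 The whole bill to r₂ ≥ 0.78 for the rim route (`rim_obstacles.py` 0.1.1 §4; README ADDENDUM C2; p1 gen 19 INFORMATION #9 supplement)

LEAD NOTE 9 (2)'s owed number is r₂ ≥ 0.78, i.e. (p1 g18's yardstick) a level-two sup velocity `U₂* = 0.78·2·U₁(t_U1) = 1.56·U₁max` on the leg as it is. For the rim
content this is not '×3 then read r₂' but a FACTOR `U₂*/(a·U₂sup)` from its own u-proxy (`a·U₂sup`; the proxy ASSUMES the rim content carries |u| per |ω| like the
SUP — inside [9,17) off by at most ×1.9, the 'allowance'), to be paid inside the ring's remaining stretching LIFE (to the level-one strain zero) at some own total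
log-rate ρ: `exp (ρ·LIFE/2) ≥ FACTOR`, i.e. `ρ·LIFE ≥ 2·log FACTOR`. -/

/-- **RATE × LIFE A FACTOR NEEDS.** Reaching a factor `F` at own log-rate `ρ` (of the squared amplitude) within `L` means `F ≤ exp (ρ L / 2)`; if `F > exp 3`
this forces `ρ·L > 6`, and if `F > exp 2` it forces `ρ·L > 4`. With `exp 1 < 2.7182818286`: `exp 3 < 20.09` and `exp 2 < 7.39`. -/
theorem rate_mul_life_gt_of_reach {ρ L F c : ℝ} (hreach : F ≤ Real.exp (ρ * L / 2)) (hF : Real.exp c < F) : 2 * c < ρ * L := by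
  have h : Real.exp c < Real.exp (ρ * L / 2) := hF.trans_le hreach
  rw [Real.exp_lt_exp] at h; linarith

/-- `exp 3 < 20.09` and `exp 2 < 7.39`. -/
theorem exp_three_lt_and_exp_two_lt : Real.exp 3 < 20.09 ∧ Real.exp 2 < 7.39 := by
  have h1 := Real.exp_one_lt_d9
  have h0 := Real.exp_pos (1:ℝ)
  have e3 : Real.exp 3 = Real.exp 1 * Real.exp 1 * Real.exp 1 := by rw [← Real.exp_add, ← Real.exp_add]; norm_num
  have e2 : Real.exp 2 = Real.exp 1 * Real.exp 1 := by rw [← Real.exp_add]; norm_num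
  constructor
  · rw [e3]; nlinarith [mul_pos h0 h0, mul_lt_mul'' h1 h1 h0.le h0.le]
  · rw [e2]; nlinarith [mul_lt_mul'' h1 h1 h0.le h0.le]

/-- Hence: a bill `F ≥ 20.09` needs `ρ·L > 6`; a bill `F ≥ 7.39` (every ring's bill even with the ×1.9 allowance, and the harmonic SUP's own bill) needs `ρ·L > 4`. -/
theorem bill_needs {ρ L F : ℝ} (hreach : F ≤ Real.exp (ρ * L / 2)) :
    (20.09 ≤ F → 6 < ρ * L) ∧ (7.39 ≤ F → 4 < ρ * L) := by
  obtain ⟨h3, h2⟩ := exp_three_lt_and_exp_two_lt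
  exact ⟨fun hF => by have := rate_mul_life_gt_of_reach hreach (h3.trans_le hF); linarith,
    fun hF => by have := rate_mul_life_gt_of_reach hreach (h2.trans_le hF); linarith⟩

/-- One leg's bill row (reader §4): level-one peak velocity, the level-two peak of record, the target `U₂* = 1.56·U₁max`, the rim content's u-proxy at the floor
crossing row 1.15 and at the window-end row 1.65, the stretching life left at those rows (level-one strain zero − t), the factors and the own rates needed
(as-is; 'allow' = factor ÷ 1.9). -/
structure BillRow where
  (u1max u2max u2target proxy115 proxy165 life115 life165 : ℝ)
  (factor115 factor115allow factor165 rate115 rate115allow rate165 : ℝ)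

/-- rings D-128 / D-192 / E-128. -/
def bill : Fin 3 → BillRow :=
  ![⟨5.35, 2.15, 8.34, 0.27, 0.45, 1.13, 0.63, 31.0, 16.3, 18.6, 6.10, 4.96, 9.34⟩,
    ⟨5.39, 2.24, 8.41, 0.31, 0.47, 1.11, 0.61, 27.4, 14.4, 18.1, 5.95, 4.80, 9.44⟩,
    ⟨5.30, 2.17, 8.26, 0.33, 0.74, 1.07, 0.57, 24.8, 13.1, 11.2, 6.02, 4.82, 8.51⟩]

/-- the arc comparator A-128 (its level-two winner is the carrier of record nearest the bar). -/
def billArc : BillRow := ⟨2.60, 3.39, 4.06, 0.59, 0.34, 1.98, 1.48, 6.9, 3.6, 11.8, 1.95, 1.30, 3.33⟩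

/-- **THE RINGS' BILL FROM THE FLOOR CROSSING**: target 8.26–8.41 (= 1.56·U₁max to 0.01), u-proxy 0.27–0.33 ⇒ factor ×24.8–31.0 (×13.1–16.3 with the allowance) inside
a life of 1.07–1.13 ⇒ own rate needed 5.95–6.10 per unit (4.80–4.96 with the allowance); from the window's end ×11–19 inside 0.57–0.63 ⇒ 8.5–9.4 per unit.
The record's r₂ on these legs is u2max/(2·u1max) ≤ 0.21. -/
theorem rings_bill (i : Fin 3) :
    (|(bill i).u2target - 1.56 * (bill i).u1max| ≤ 0.01 ∧ 8.26 ≤ (bill i).u2target) ∧ (0.27 ≤ (bill i).proxy115 ∧ (bill i).proxy115 ≤ 0.33) ∧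
    (24.8 ≤ (bill i).factor115 ∧ 13.1 ≤ (bill i).factor115allow ∧ 11.2 ≤ (bill i).factor165) ∧ ((bill i).life115 ≤ 1.13 ∧ (bill i).life165 ≤ 0.63) ∧
    (5.95 ≤ (bill i).rate115 ∧ 4.80 ≤ (bill i).rate115allow ∧ 8.5 ≤ (bill i).rate165) ∧ (bill i).u2max / (2 * (bill i).u1max) ≤ 0.21 := by
  fin_cases i <;> simp [bill] <;> norm_num

/-- **THE RECORD'S RATES DO NOT PAY IT.** By `bill_needs`, a factor ≥ 24.8 (> 20.09) inside L ≤ 1.13 needs ρ > 6/1.13 > 5.3, and even the allowance bill (≥ 13.1 > 7.39)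
needs ρ > 4/1.13 > 3.5 — against the rim's record late total ≤ 3.03 (`CarrierFloorWindow.rim`): ρ·L ≤ 3.43 < 4. The largest 0.30-sustained site total on the record
(+5.90) gives ρ·L ≤ 6.67 > 6 — about the as-is bill only if held for the WHOLE life from the floor crossing with no reversal and no competitor. -/
theorem record_rates_vs_bill (i : Fin 3) :
    (rim i).totL * (bill i).life115 < 4 ∧ (6 : ℝ) < 5.90 * (bill i).life115 ∧ 5.90 * (bill i).life165 < 4 := by
  fin_cases i <;> simp [bill, rim] <;> norm_num

/-- Instantiating `bill_needs` on the rings: whatever own rate ρ pays the as-is bill from the floor crossing has ρ·life > 6, hence ρ > 5.3; whatever pays the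
allowance bill has ρ > 3.5 (> the rim's record 3.03). -/
theorem rings_rate_needed (i : Fin 3) {ρ : ℝ} :
    ((bill i).factor115 ≤ Real.exp (ρ * (bill i).life115 / 2) → 5.3 < ρ) ∧ ((bill i).factor115allow ≤ Real.exp (ρ * (bill i).life115 / 2) → 3.5 < ρ) := by
  obtain ⟨-, -, ⟨hf, hfa, -⟩, ⟨hl, -⟩, -⟩ := rings_bill i
  have hlpos : 0 < (bill i).life115 := by fin_cases i <;> simp [bill] <;> norm_num
  refine ⟨fun h => ?_, fun h => ?_⟩
  · have h6 := (bill_needs h).1 (by linarith)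
    by_contra hρ; push Not at hρ
    have : ρ * (bill i).life115 ≤ 5.3 * 1.13 := by nlinarith
    linarith
  · have h4 := (bill_needs h).2 (by linarith)
    by_contra hρ; push Not at hρ
    have : ρ * (bill i).life115 ≤ 3.5 * 1.13 := by nlinarith
    linarith

/-- **THE DICHOTOMY OF RECORD IN ONE CURRENCY.** Against the arc A-128 at the same instant 1.15: the ring's target is ≥ 2.03× the arc's (level-one amplitude 5.3 vs
2.6), its life ≤ 0.58× (1.07–1.13 vs 1.98), its starting proxy ≤ 0.56×, so its rate needed is ≥ 3.0× (5.95–6.10 vs 1.95); the arc's winner paid its bill to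
≥ 83 % (u2max/u2target), the rings' level two to ≤ 27 %. -/
theorem dichotomy_in_one_currency (i : Fin 3) :
    2.03 * billArc.u2target ≤ (bill i).u2target ∧ (bill i).life115 ≤ 0.58 * billArc.life115 ∧ (bill i).proxy115 ≤ 0.56 * billArc.proxy115 ∧
    3.0 * billArc.rate115 ≤ (bill i).rate115 ∧ (0.83 ≤ billArc.u2max / billArc.u2target ∧ (bill i).u2max / (bill i).u2target ≤ 0.27) := by
  fin_cases i <;> simp [bill, billArc] <;> norm_num

end Summit.NavierStokesRegularity.FluidComputer.RimRoutePrice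

end
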